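import Mathlib
import Literature.Analysis.FluidPDE.ClassicalSolution
import Literature.Analysis.FluidPDE.ClassicalSolutionCalculus
import Literature.Analysis.FluidPDE.NSVorticityDifference
import Literature.Analysis.FluidPDE.TypeIAncientMildClassical
import Literature.Analysis.FluidPDE.TypeIAncientMildDecay
import Literature.Analysis.FluidPDE.SelfSimilar
import Summits.NavierStokesRegularity.NavierStokesRegularity.Theorems.TypeIQuarterGateScarEnvelopeTypeISatelliteTowerDefs
import Literature.Analysis.FluidPDE.LinWang2022ThreeCylinder
import Summits.NavierStokesRegularity.NavierStokesRegularity.Theorems.DssFarFieldSlavingBlowupTypeIDssProfileSimilarityEnstrophySpaceThreshold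
import Summits.NavierStokesRegularity.NavierStokesRegularity.Theorems.StableStrataDoorOneSliceAxiSeq

/-!
# Satellite tower for crux `ScarEnvelopeTypeI` (stmt-NavierStokesRegularity-23843) — ROUND-48 Part L: EFFECTIVE-IN-FORM SPATIAL KEYHOLE TRANSFER, CONDITIONAL on the typed Lin–Wang 2022 three-cylinder fact (difference of two NS solutions = generalized Stokes; same-time three-cylinder transfer with explicit exponent κ for differences of enveloped Type-I ancient mild pairs; census currency for enveloped A–B objects)

Module (28b) of the landing form: (L2) `isClassicalGenStokesOn_sub` (two classical NS solutions ⇒ their difference solves the classical generalized Stokes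
system with `A = U`, `B = ∇W`); `norm_le_rpow_of_hasTypeIDecay`, `norm_le_rpow_of_gradient_bound` (coefficient bounds in Lin–Wang's form); (L3)
`typeIAncient_difference_threeCylinder` (hLW ⇒ same-time spatial three-cylinder transfer for differences of enveloped Type-I ancient mild pairs with ONE
constant for all keyhole radii `R₁` and all pairs); (L4) `typeIAncient_difference_keyholeModulus` (class-uniform Hölder keyhole modulus `δ ↦ Ct·(…)^{1−κ} δ^κ`);
(L5) `abTower_difference_keyholeModulus` (census currency: two `ABTower M`
objects with a common envelope `HasTypeIDecay A`).  All (L3)–(L5) CONDITIONAL on `hLW : LinWang2022ThreeCylinder` (imported Literature fact, unproved).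

PROVENANCE: declaration texts VERBATIM from the HOME artefact of the instrument seat nsreg-p3 g29 (cell `pub/ns-regularity-ideate`):
`round-48/partL48.lean` v1.3 (sha16 `f60089544b879751`; ONE section `EffectiveKeyhole`; memo `round-48/ROUND-48.md` v1.3 34b025f94c8d2102), scored by referee
ref3 g28/g29 (`SCORE-p3-ROUND-48-0828.md` 978955580cd2536f, PASS ★ → ★★ by the F1 path, + ADDENDUM 857a836951057d6f acknowledging v1.3 and fixing the (28b) criteria F6); the author cannot write under `Theorems/` (`perm.theorems-prover-only`); landed by the prover ns-es-p1 g6 as landing hand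
of record (director-ns DIRECTOR-NS #237 (3)) following the landing form ROUND-48.md §3 (28b): the plate's inline copies of `IsClassicalGenStokesOn`,
`linWangKappa`, `linWangKappa_pos_lt_one`, `LinWang2022ThreeCylinder` (plate audit `vendored-fact = 2`) are NOT landed here — they are the Literature
module `Literature/Analysis/FluidPDE/LinWang2022ThreeCylinder.lean` ((28a) p678372 + (28a′) p678500, landed by nsreg-lit g22 in the Literature lane), imported BY NAME — per ref3 F6 the v1.3 consumers obtain the hedged inner-radius shape as `hLW.innerRadiusHedged` (ONE token rewritten in (L3)'s proof, plate l.256); the plate's two monotonicity lemmas `isTypeIAncientMild_of_le` / `hasTypeIDecay_of_le` (l.361–372) are NOT landed — they restate tree lemmas (gate `dedup.landed`: `…TargetNegative.HeadInfluxLawCostume.isTypeIAncientMild_of_le`, `…StableStrataDoorOneSliceAxiSeq.hasTypeIDecay_mono`) and (L5)'s four uses are REWRITTEN to the tree's `…Theorems.SimilarityEnstrophy.isTypeIAncientMild_mono` (same statement up to binder order; built on the farm) and `…Theorems.StableStrataDoorOneSliceAxiSeq.hasTypeIDecay_mono`.  These three token rewrites are the only deviations from VERBATIM; statements of the 6 landed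 decls are byte-identical to the plate's.  The artefact's `#guard_msgs … #print axioms` certificates are not landed.
`--supports stmt-NavierStokesRegularity-23843 --as helper`.

HONEST FRAMING: CONDITIONAL effective-in-form spatial keyhole transfer for differences of enveloped Type-I ancient mild fields / census A–B objects —
EVERY load-bearing statement (L3)(L4)(L5) takes the UNPROVED printed theorem `LinWang2022ThreeCylinder` (Lin–Wang 2022 Thm 1.1, typed special case) as
a HYPOTHESIS `hLW` (conditional-result; tracked Literature debt).  Theorems about HYPOTHETICAL Type-I zoom limits (classes possibly empty).  Movement 0 on
anything open: item 23843, route TypeIQuarterGate, crux 1589 `RecurrentLiouville`, (ρ)/(θ′)/(υ), the DSS cells (τ)(κ), N0 and Navier–Stokes regularity are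
all OPEN — NS regularity is NOT proved here.  The TIME leg of an effective keyhole transfer is not in print and not claimed; (q1) — a quantitative
Liouville theorem for almost self-similar Type-I ancient solutions — is the hard core and untouched.
-/

-- the summit-side namespace repeats a component by design (single-conjunct summit, D-0017)
set_option linter.dupNamespace false

open MeasureTheory Set Function Filter Topology
open scoped ENNReal Laplacian ContDiff

namespace Summit.NavierStokesRegularity.NavierStokesRegularity.Cruxes.ScarEnvelopeTypeI.ZoomDictionary

section EffectiveKeyhole

open Literature.Analysis.FluidPDE

/-- (L2) **Bridge.** The difference `w = U − W`, `π = P − Q` of two classical Navier–Stokes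
solutions (`ν = 1`, no force) on the same time set solves the classical generalized Stokes system
with drift `A = U` and zeroth-order coefficient `B = ∇W` (`(Bw)(x) = DW(x)[w(x)] = (w·∇)W`):
`(U·∇)U − (W·∇)W = (U·∇)w + (w·∇)W` (tree: `IsClassicalNSSolutionOn.timeDerivWithin_sub_eq`). -/
theorem isClassicalGenStokesOn_sub {S : Set ℝ}
    {U W : ℝ → EuclideanSpace ℝ (Fin 3) → EuclideanSpace ℝ (Fin 3)}
    {P Q : ℝ → EuclideanSpace ℝ (Fin 3) → ℝ}
    (hU : IsClassicalNSSolutionOn S 1 0 U P) (hW : IsClassicalNSSolutionOn S 1 0 W Q) :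
    IsClassicalGenStokesOn S U (fun t x => fderiv ℝ (W t) x) (U - W) (P - Q) := by
  refine ⟨?_, ?_, ?_, ?_⟩
  · exact hU.smooth_velocity.sub hW.smooth_velocity
  · exact hU.smooth_pressure.sub hW.smooth_pressure
  · intro t ht x
    rw [hU.timeDerivWithin_sub_eq hW ht x, one_smul]
    simp only [convect]
    abel
  · intro t ht
    exact hU.isDivFree_sub hW ht

/-- Coefficient bound for the drift: an enveloped field (`‖U(t,x)‖ ≤ C/(‖x‖ + √(−t))`) satisfies
`‖U(t,x)‖ ≤ C ‖x‖^{−1+ε}` for `x ≠ 0` at times `t ≤ −1`, any `ε ∈ [0,1]`. -/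
theorem norm_le_rpow_of_hasTypeIDecay {C : ℝ}
    {U : ℝ → EuclideanSpace ℝ (Fin 3) → EuclideanSpace ℝ (Fin 3)} (hUd : HasTypeIDecay C U)
    {eps : ℝ} (heps0 : 0 ≤ eps) (heps1 : eps ≤ 1) {t : ℝ} (ht : t ≤ -1)
    {x : EuclideanSpace ℝ (Fin 3)} (hx : x ≠ 0) : ‖U t x‖ ≤ C * ‖x‖ ^ (-1 + eps) := by
  have ht0 : t < 0 := by linarith
  have hsq : 1 ≤ Real.sqrt (-t) := by
    rw [show (1 : ℝ) = Real.sqrt 1 by simp]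
    exact Real.sqrt_le_sqrt (by linarith)
  have hC0 : 0 ≤ C := by
    have h := (norm_nonneg _).trans (hUd t ht0 0)
    rw [norm_zero, zero_add] at h
    exact (div_nonneg_iff.1 h).elim (fun h => h.1) fun h => by
      exfalso; linarith [h.2, Real.sqrt_nonneg (-t)]
  have hxpos : 0 < ‖x‖ := norm_pos_iff.2 hx
  have hden : 0 < ‖x‖ + Real.sqrt (-t) := by positivity
  refine (hUd t ht0 x).trans ?_
  rcases le_or_gt ‖x‖ 1 with hx1 | hx1
  · -- `C/(‖x‖+√(−t)) ≤ C ≤ C ‖x‖^{−1+ε}`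
    have h1 : C / (‖x‖ + Real.sqrt (-t)) ≤ C := by
      rw [div_le_iff₀ hden]; nlinarith
    have h2 : (1 : ℝ) ≤ ‖x‖ ^ (-1 + eps) :=
      Real.one_le_rpow_of_pos_of_le_one_of_nonpos hxpos hx1 (by linarith)
    calc C / (‖x‖ + Real.sqrt (-t)) ≤ C := h1
      _ = C * 1 := (mul_one C).symm
      _ ≤ C * ‖x‖ ^ (-1 + eps) := mul_le_mul_of_nonneg_left h2 hC0
  · -- `C/(‖x‖+√(−t)) ≤ C/‖x‖ = C ‖x‖^{−1} ≤ C ‖x‖^{−1+ε}`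
    have h1 : C / (‖x‖ + Real.sqrt (-t)) ≤ C / ‖x‖ :=
      div_le_div_of_nonneg_left hC0 hxpos (by linarith [Real.sqrt_nonneg (-t)])
    have h2 : C / ‖x‖ = C * ‖x‖ ^ (-1 : ℝ) := by
      rw [Real.rpow_neg_one, div_eq_mul_inv]
    have h3 : ‖x‖ ^ (-1 : ℝ) ≤ ‖x‖ ^ (-1 + eps) :=
      Real.rpow_le_rpow_of_exponent_le hx1.le (by linarith)
    calc C / (‖x‖ + Real.sqrt (-t)) ≤ C / ‖x‖ := h1
      _ = C * ‖x‖ ^ (-1 : ℝ) := h2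
      _ ≤ C * ‖x‖ ^ (-1 + eps) := mul_le_mul_of_nonneg_left h3 hC0

/-- Coefficient bound for the zeroth-order term: a gradient bound
`‖DW(t,x)‖ ≤ K (max ‖x‖ √(−t))^{−2}` gives `‖DW(t,x)‖ ≤ K ‖x‖^{−2+ε}` for `x ≠ 0`, `t ≤ −1`. -/
theorem norm_le_rpow_of_gradient_bound {K : ℝ} (hK : 0 ≤ K)
    {G : EuclideanSpace ℝ (Fin 3) →L[ℝ] EuclideanSpace ℝ (Fin 3)}
    {eps : ℝ} (heps0 : 0 ≤ eps) (heps1 : eps ≤ 1) {t : ℝ} (ht : t ≤ -1)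
    {x : EuclideanSpace ℝ (Fin 3)} (hx : x ≠ 0)
    (hG : ‖G‖ ≤ K * ((max ‖x‖ (Real.sqrt (-t)))⁻¹) ^ (1 + 1)) :
    ‖G‖ ≤ K * ‖x‖ ^ (-2 + eps) := by
  have hsq : 1 ≤ Real.sqrt (-t) := by
    rw [show (1 : ℝ) = Real.sqrt 1 by simp]
    exact Real.sqrt_le_sqrt (by linarith)
  have hxpos : 0 < ‖x‖ := norm_pos_iff.2 hx
  set m : ℝ := max ‖x‖ (Real.sqrt (-t)) with hm
  have hm1 : 1 ≤ m := hsq.trans (le_max_right _ _)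
  have hmx : ‖x‖ ≤ m := le_max_left _ _
  have hmpos : 0 < m := by linarith
  refine hG.trans ?_
  rcases le_or_gt ‖x‖ 1 with hx1 | hx1
  · have h1 : (m⁻¹) ^ (1 + 1) ≤ 1 := by
      have : m⁻¹ ≤ 1 := inv_le_one_of_one_le₀ hm1
      have h0 : 0 ≤ m⁻¹ := by positivity
      nlinarith
    have h2 : (1 : ℝ) ≤ ‖x‖ ^ (-2 + eps) :=
      Real.one_le_rpow_of_pos_of_le_one_of_nonpos hxpos hx1 (by linarith)
    calc K * (m⁻¹) ^ (1 + 1) ≤ K * 1 := mul_le_mul_of_nonneg_left h1 hK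
      _ ≤ K * ‖x‖ ^ (-2 + eps) := mul_le_mul_of_nonneg_left h2 hK
  · have h1 : (m⁻¹) ^ (1 + 1) ≤ (‖x‖⁻¹) ^ (1 + 1) := by
      have : m⁻¹ ≤ ‖x‖⁻¹ := (inv_le_inv₀ hmpos hxpos).2 hmx
      have h0 : 0 ≤ m⁻¹ := by positivity
      exact pow_le_pow_left₀ h0 this _
    have h2 : (‖x‖⁻¹) ^ (1 + 1) = ‖x‖ ^ (-2 : ℝ) := by
      rw [show ((1:ℕ) + 1) = 2 from rfl, Real.rpow_neg hxpos.le, inv_pow,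
        show (2 : ℝ) = ((2 : ℕ) : ℝ) by norm_num, Real.rpow_natCast]
    have h3 : ‖x‖ ^ (-2 : ℝ) ≤ ‖x‖ ^ (-2 + eps) :=
      Real.rpow_le_rpow_of_exponent_le hx1.le (by linarith)
    calc K * (m⁻¹) ^ (1 + 1) ≤ K * (‖x‖⁻¹) ^ (1 + 1) := mul_le_mul_of_nonneg_left h1 hK
      _ = K * ‖x‖ ^ (-2 : ℝ) := by rw [h2]
      _ ≤ K * ‖x‖ ^ (-2 + eps) := mul_le_mul_of_nonneg_left h3 hK

/-- (L3) **Same-time spatial three-cylinder transfer for differences of enveloped Type-I ancient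
mild solutions, conditional on the typed Lin–Wang fact, EXPLICIT in form.** For the class
`{V : IsTypeIAncientMild C V ∧ HasTypeIDecay C V}` (KNSS gauge, `ν = 1`) and cylinders centred at
`(t, x) = (−2, 0)` with half-height `T ≤ 1` (so the unit time window `(−3,−1)` stays at parabolic
distance `≥ 1` from the blow-up time) and outer radius below a threshold `R̂(C) > 0` (Lin–Wang's
`R̂(λ(C), 1/2)`), there is ONE constant `Ct = Ct(C, T, t₀, R₂, R₃)` — not depending on `R₁` nor on
the pair `(U, W)` — and an inner-radius bound `ρ > 0` (solution-independent) with, for `R₁ ≤ ρ`,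
`∬_{mid} |U−W|² ≤ Ct (∬_{inner, radius R₁} |U−W|²)^κ (∬_{outer, radius R₃} |U−W|²)^{1−κ}`,
`κ = linWangKappa R₁ R₂ R₃` explicit. Other centres/scales follow by the scaling covariance of
the class (not restated). Coefficients: `A = U` (envelope ⇒ `λ_A = C`), `B = ∇W` with the
class-uniform gradient bound `IsTypeIAncientMild.exists_forall_norm_iteratedFDeriv_le_of_hasTypeIDecay`
(⇒ `λ_B = K(1, C)`), exponent `ε = 1/2`; pressures from
`IsTypeIAncientMild.exists_isClassicalNSSolutionOn_Ioo` (Fabes–Jones–Rivière). -/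
theorem typeIAncient_difference_threeCylinder (hLW : LinWang2022ThreeCylinder) (C : ℝ) :
    ∃ Rhat : ℝ, 0 < Rhat ∧ ∀ (T t₀ : ℝ), 0 < t₀ → t₀ < T → T ≤ 1 →
    ∀ (R₂ R₃ : ℝ), 0 < R₂ → R₂ < R₃ / 3 → R₃ / 3 < Rhat →
    ∃ Ct : ℝ, 0 < Ct ∧ ∃ ρ : ℝ, 0 < ρ ∧ ∀ (R₁ : ℝ), 0 < R₁ → R₁ < R₂ → R₁ ≤ ρ →
      ∀ (U W : ℝ → EuclideanSpace ℝ (Fin 3) → EuclideanSpace ℝ (Fin 3)),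
        IsTypeIAncientMild C U → HasTypeIDecay C U →
        IsTypeIAncientMild C W → HasTypeIDecay C W →
        ∫ z in Ioo (-2 - (T - t₀)) (-2 + (T - t₀)) ×ˢ Metric.ball (0 : EuclideanSpace ℝ (Fin 3)) R₂,
            ‖U z.1 z.2 - W z.1 z.2‖ ^ 2 ≤
          Ct * (∫ z in Ioo (-2 - T) (-2 + T) ×ˢ Metric.ball (0 : EuclideanSpace ℝ (Fin 3)) R₁,
                  ‖U z.1 z.2 - W z.1 z.2‖ ^ 2) ^ linWangKappa R₁ R₂ R₃ *
              (∫ z in Ioo (-2 - T) (-2 + T) ×ˢ Metric.ball (0 : EuclideanSpace ℝ (Fin 3)) R₃,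
                  ‖U z.1 z.2 - W z.1 z.2‖ ^ 2) ^ (1 - linWangKappa R₁ R₂ R₃) := by
  -- class-uniform gradient bound (Pineau–Vicol Lemma 7.2 packaging in the tree)
  obtain ⟨K, hK0, hK⟩ := IsTypeIAncientMild.exists_forall_norm_iteratedFDeriv_le_of_hasTypeIDecay 1 C
  set lam : ℝ := max (max C K) 1 with hlam
  have hlam0 : 0 < lam := lt_of_lt_of_le one_pos (le_max_right _ _)
  have hClam : C ≤ lam := (le_max_left _ _).trans (le_max_left _ _)
  have hKlam : K ≤ lam := (le_max_right _ _).trans (le_max_left _ _)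
  obtain ⟨Rhat, hRhat, hLW'⟩ := hLW.innerRadiusHedged lam (1/2) hlam0 (by norm_num) (by norm_num)
  refine ⟨Rhat, hRhat, fun T t₀ ht₀ ht₀T hT R₂ R₃ hR₂ hR₂₃ hR₃ => ?_⟩
  obtain ⟨Ct, hCt, ρ, hρ, h⟩ := hLW' T t₀ ht₀ ht₀T hT R₂ R₃ hR₂ hR₂₃ hR₃
  refine ⟨Ct, hCt, ρ, hρ, fun R₁ hR₁ hR₁₂ hR₁ρ U W hU hUd hW hWd => ?_⟩
  -- pressures making `U`, `W` classical on `(−4, 0)`, restricted to `(−2 − 3/2, −2 + 3/2)`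
  obtain ⟨P, hP⟩ := hU.exists_isClassicalNSSolutionOn_Ioo (t₀ := -4) (by norm_num)
  obtain ⟨Q, hQ⟩ := hW.exists_isClassicalNSSolutionOn_Ioo (t₀ := -4) (by norm_num)
  have hsub : Ioo (-2 - 3/2 : ℝ) (-2 + 3/2) ⊆ Ioo (-4) 0 := Ioo_subset_Ioo (by norm_num) (by norm_num)
  have hP' := hP.mono hsub (uniqueDiffOn_Ioo _ _)
  have hQ' := hQ.mono hsub (uniqueDiffOn_Ioo _ _)
  have hGS := isClassicalGenStokesOn_sub hP' hQ'
  -- coefficient bounds on the unit window `(−3, −1)`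
  have hA : ∀ t ∈ Ioo ((-2 : ℝ) - 1) (-2 + 1), ∀ x : EuclideanSpace ℝ (Fin 3), x ≠ 0 →
      ‖U t x‖ ≤ lam * ‖x‖ ^ (-1 + (1/2 : ℝ)) := by
    intro t ht x hx
    have ht1 : t ≤ -1 := by linarith [ht.2]
    refine (norm_le_rpow_of_hasTypeIDecay hUd (eps := 1/2) (by norm_num) (by norm_num) ht1 hx).trans ?_
    exact mul_le_mul_of_nonneg_right hClam (Real.rpow_nonneg (norm_nonneg _) _)
  have hB : ∀ t ∈ Ioo ((-2 : ℝ) - 1) (-2 + 1), ∀ x : EuclideanSpace ℝ (Fin 3), x ≠ 0 →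
      ‖(fun t x => fderiv ℝ (W t) x) t x‖ ≤ lam * ‖x‖ ^ (-2 + (1/2 : ℝ)) := by
    intro t ht x hx
    have ht1 : t ≤ -1 := by linarith [ht.2]
    have ht0 : t < 0 := by linarith
    have hG : ‖fderiv ℝ (W t) x‖ ≤ K * ((max ‖x‖ (Real.sqrt (-t)))⁻¹) ^ (1 + 1) := by
      have := hK hW hWd t ht0 x
      rwa [← norm_iteratedFDeriv_fderiv, norm_iteratedFDeriv_zero] at this
    refine (norm_le_rpow_of_gradient_bound hK0 (eps := 1/2) (by norm_num) (by norm_num) ht1 hx hG).trans ?_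
    exact mul_le_mul_of_nonneg_right hKlam (Real.rpow_nonneg (norm_nonneg _) _)
  have key := h R₁ hR₁ hR₁₂ hR₁ρ (-2) (3/2) (by norm_num) U (fun t x => fderiv ℝ (W t) x) (U - W)
    (P - Q) hA hB hGS
  simpa only [Pi.sub_apply] using key

/-- (L4) **Explicit keyhole modulus (K1-spatial, effective in form).** With the outer cylinder
controlled by the envelope (`‖U‖, ‖W‖ ≤ C` at times `≤ −1`, so `∬_{outer} |U−W|² ≤ 4C²·|outer|`),
(L3) becomes a class-uniform Hölder modulus: smallness `δ` of `∬_{inner} |U−W|²` on the keyhole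
cylinder of radius `R₁` forces `∬_{mid} |U−W|² ≤ Ct · (4C²|outer|)^{1−κ} · δ^κ`, `κ` explicit. -/
theorem typeIAncient_difference_keyholeModulus (hLW : LinWang2022ThreeCylinder) (C : ℝ) :
    ∃ Rhat : ℝ, 0 < Rhat ∧ ∀ (T t₀ : ℝ), 0 < t₀ → t₀ < T → T ≤ 1 →
    ∀ (R₂ R₃ : ℝ), 0 < R₂ → R₂ < R₃ / 3 → R₃ / 3 < Rhat →
    ∃ Ct : ℝ, 0 < Ct ∧ ∃ ρ : ℝ, 0 < ρ ∧ ∀ (R₁ : ℝ), 0 < R₁ → R₁ < R₂ → R₁ ≤ ρ →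
      ∀ (U W : ℝ → EuclideanSpace ℝ (Fin 3) → EuclideanSpace ℝ (Fin 3)),
        IsTypeIAncientMild C U → HasTypeIDecay C U →
        IsTypeIAncientMild C W → HasTypeIDecay C W →
        ∫ z in Ioo (-2 - (T - t₀)) (-2 + (T - t₀)) ×ˢ Metric.ball (0 : EuclideanSpace ℝ (Fin 3)) R₂,
            ‖U z.1 z.2 - W z.1 z.2‖ ^ 2 ≤
          Ct * (4 * C ^ 2 * (volume (Ioo (-2 - T) (-2 + T) ×ˢ
                  Metric.ball (0 : EuclideanSpace ℝ (Fin 3)) R₃)).toReal) ^ (1 - linWangKappa R₁ R₂ R₃) *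
            (∫ z in Ioo (-2 - T) (-2 + T) ×ˢ Metric.ball (0 : EuclideanSpace ℝ (Fin 3)) R₁,
                ‖U z.1 z.2 - W z.1 z.2‖ ^ 2) ^ linWangKappa R₁ R₂ R₃ := by
  obtain ⟨Rhat, hRhat, h3⟩ := typeIAncient_difference_threeCylinder hLW C
  refine ⟨Rhat, hRhat, fun T t₀ ht₀ ht₀T hT R₂ R₃ hR₂ hR₂₃ hR₃ => ?_⟩
  obtain ⟨Ct, hCt, ρ, hρ, h⟩ := h3 T t₀ ht₀ ht₀T hT R₂ R₃ hR₂ hR₂₃ hR₃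
  refine ⟨Ct, hCt, ρ, hρ, fun R₁ hR₁ hR₁₂ hR₁ρ U W hU hUd hW hWd => ?_⟩
  have key := h R₁ hR₁ hR₁₂ hR₁ρ U W hU hUd hW hWd
  obtain ⟨hκ0, hκ1⟩ := linWangKappa_pos_lt_one hR₁ hR₁₂ hR₂₃
  set κ := linWangKappa R₁ R₂ R₃ with hκ
  set Sout : Set (ℝ × EuclideanSpace ℝ (Fin 3)) :=
    Ioo (-2 - T) (-2 + T) ×ˢ Metric.ball (0 : EuclideanSpace ℝ (Fin 3)) R₃ with hSout
  -- envelope bound on the outer cylinder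
  have hC0 : 0 ≤ C := by
    have h := (norm_nonneg _).trans (hUd (-1) (by norm_num) 0)
    rw [norm_zero, zero_add, neg_neg, Real.sqrt_one, div_one] at h
    exact h
  have hbound : ∀ z ∈ Sout, ‖‖U z.1 z.2 - W z.1 z.2‖ ^ 2‖ ≤ 4 * C ^ 2 := by
    intro z hz
    have hz1 : z.1 ∈ Ioo (-2 - T) (-2 + T) := hz.1
    have ht0 : z.1 < 0 := by linarith [hz1.2]
    have hsq : 1 ≤ Real.sqrt (-z.1) := by
      rw [show (1 : ℝ) = Real.sqrt 1 by simp]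
      exact Real.sqrt_le_sqrt (by linarith [hz1.2])
    have hden : ∀ y : EuclideanSpace ℝ (Fin 3), 1 ≤ ‖y‖ + Real.sqrt (-z.1) := fun y => by
      linarith [norm_nonneg y]
    have hUz : ‖U z.1 z.2‖ ≤ C := (hUd z.1 ht0 z.2).trans <| by
      rw [div_le_iff₀ (by linarith [hden z.2])]; nlinarith [hden z.2]
    have hWz : ‖W z.1 z.2‖ ≤ C := (hWd z.1 ht0 z.2).trans <| by
      rw [div_le_iff₀ (by linarith [hden z.2])]; nlinarith [hden z.2]
    have hd : ‖U z.1 z.2 - W z.1 z.2‖ ≤ 2 * C :=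
      (norm_sub_le _ _).trans (by linarith)
    rw [Real.norm_eq_abs, abs_of_nonneg (by positivity)]
    nlinarith [norm_nonneg (U z.1 z.2 - W z.1 z.2)]
  have hvol : volume Sout < ⊤ := by
    rw [hSout, Measure.volume_eq_prod, Measure.prod_prod]
    exact ENNReal.mul_lt_top measure_Ioo_lt_top measure_ball_lt_top
  have hout : ∫ z in Sout, ‖U z.1 z.2 - W z.1 z.2‖ ^ 2 ≤ 4 * C ^ 2 * (volume Sout).toReal := by
    have h1 := norm_setIntegral_le_of_norm_le_const hvol hbound
    rw [Real.norm_eq_abs, abs_of_nonneg (integral_nonneg fun _ => by positivity)] at h1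
    simpa [Measure.real] using h1
  have hout0 : 0 ≤ ∫ z in Sout, ‖U z.1 z.2 - W z.1 z.2‖ ^ 2 := integral_nonneg fun _ => by positivity
  have hin0 : 0 ≤ ∫ z in Ioo (-2 - T) (-2 + T) ×ˢ Metric.ball (0 : EuclideanSpace ℝ (Fin 3)) R₁,
      ‖U z.1 z.2 - W z.1 z.2‖ ^ 2 := integral_nonneg fun _ => by positivity
  have hpow : (∫ z in Sout, ‖U z.1 z.2 - W z.1 z.2‖ ^ 2) ^ (1 - κ) ≤
      (4 * C ^ 2 * (volume Sout).toReal) ^ (1 - κ) :=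
    Real.rpow_le_rpow hout0 hout (by linarith)
  calc ∫ z in Ioo (-2 - (T - t₀)) (-2 + (T - t₀)) ×ˢ Metric.ball (0 : EuclideanSpace ℝ (Fin 3)) R₂,
          ‖U z.1 z.2 - W z.1 z.2‖ ^ 2
        ≤ Ct * (∫ z in Ioo (-2 - T) (-2 + T) ×ˢ Metric.ball (0 : EuclideanSpace ℝ (Fin 3)) R₁,
              ‖U z.1 z.2 - W z.1 z.2‖ ^ 2) ^ κ * (∫ z in Sout, ‖U z.1 z.2 - W z.1 z.2‖ ^ 2) ^ (1 - κ) :=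
          key
    _ ≤ Ct * (∫ z in Ioo (-2 - T) (-2 + T) ×ˢ Metric.ball (0 : EuclideanSpace ℝ (Fin 3)) R₁,
              ‖U z.1 z.2 - W z.1 z.2‖ ^ 2) ^ κ * (4 * C ^ 2 * (volume Sout).toReal) ^ (1 - κ) :=
          mul_le_mul_of_nonneg_left hpow (mul_nonneg hCt.le (Real.rpow_nonneg hin0 _))
    _ = Ct * (4 * C ^ 2 * (volume Sout).toReal) ^ (1 - κ) *
          (∫ z in Ioo (-2 - T) (-2 + T) ×ˢ Metric.ball (0 : EuclideanSpace ℝ (Fin 3)) R₁,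
              ‖U z.1 z.2 - W z.1 z.2‖ ^ 2) ^ κ := by ring

/-- (L5) **Census currency.** For two A–B tower objects (`ABTower M · · ·`, the census's engine class)
carrying a common space–time envelope constant `A` (the census's ENVELOPED objects: tame roots /
leaves, `…SatelliteTowerDssCell`, `…EnvelopeTame`), the explicit keyhole modulus (L4) holds below an
outer-radius threshold `R̂(M, A) > 0` with ONE constant `Ct = Ct(M, A, T, t₀, R₂, R₃)` for all keyhole
radii `R₁ ≤ ρ` (`ρ > 0` solution-independent) and all such pairs — conditional on the typed Lin–Wang fact. (Vacuous if that class is empty: a constraint, never a removal.) -/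
theorem abTower_difference_keyholeModulus (hLW : LinWang2022ThreeCylinder) (M A : ℝ) :
    ∃ Rhat : ℝ, 0 < Rhat ∧ ∀ (T t₀ : ℝ), 0 < t₀ → t₀ < T → T ≤ 1 →
    ∀ (R₂ R₃ : ℝ), 0 < R₂ → R₂ < R₃ / 3 → R₃ / 3 < Rhat →
    ∃ Ct : ℝ, 0 < Ct ∧ ∃ ρ : ℝ, 0 < ρ ∧ ∀ (R₁ : ℝ), 0 < R₁ → R₁ < R₂ → R₁ ≤ ρ →
      ∀ (U W : ℝ → EuclideanSpace ℝ (Fin 3) → EuclideanSpace ℝ (Fin 3))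
        (H H' : ℝ → EuclideanSpace ℝ (Fin 3) → (EuclideanSpace ℝ (Fin 3) →L[ℝ] EuclideanSpace ℝ (Fin 3)))
        (P P' : ℝ → EuclideanSpace ℝ (Fin 3) → ℝ),
        ABTower M U P H → HasTypeIDecay A U → ABTower M W P' H' → HasTypeIDecay A W →
        ∫ z in Ioo (-2 - (T - t₀)) (-2 + (T - t₀)) ×ˢ Metric.ball (0 : EuclideanSpace ℝ (Fin 3)) R₂,
            ‖U z.1 z.2 - W z.1 z.2‖ ^ 2 ≤
          Ct * (4 * (max M A) ^ 2 * (volume (Ioo (-2 - T) (-2 + T) ×ˢ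
                  Metric.ball (0 : EuclideanSpace ℝ (Fin 3)) R₃)).toReal) ^ (1 - linWangKappa R₁ R₂ R₃) *
            (∫ z in Ioo (-2 - T) (-2 + T) ×ˢ Metric.ball (0 : EuclideanSpace ℝ (Fin 3)) R₁,
                ‖U z.1 z.2 - W z.1 z.2‖ ^ 2) ^ linWangKappa R₁ R₂ R₃ := by
  obtain ⟨Rhat, hRhat, h4⟩ := typeIAncient_difference_keyholeModulus hLW (max M A)
  refine ⟨Rhat, hRhat, fun T t₀ ht₀ ht₀T hT R₂ R₃ hR₂ hR₂₃ hR₃ => ?_⟩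
  obtain ⟨Ct, hCt, ρ, hρ, h⟩ := h4 T t₀ ht₀ ht₀T hT R₂ R₃ hR₂ hR₂₃ hR₃
  refine ⟨Ct, hCt, ρ, hρ, fun R₁ hR₁ hR₁₂ hR₁ρ U W H H' P P' hU hUd hW hWd => ?_⟩
  exact h R₁ hR₁ hR₁₂ hR₁ρ U W (Summit.NavierStokesRegularity.NavierStokesRegularity.Theorems.SimilarityEnstrophy.isTypeIAncientMild_mono hU.1 (le_max_left _ _))
    (Summit.NavierStokesRegularity.NavierStokesRegularity.Theorems.StableStrataDoorOneSliceAxiSeq.hasTypeIDecay_mono hUd (le_max_right _ _)) (Summit.NavierStokesRegularity.NavierStokesRegularity.Theorems.SimilarityEnstrophy.isTypeIAncientMild_mono hW.1 (le_max_left _ _))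
    (Summit.NavierStokesRegularity.NavierStokesRegularity.Theorems.StableStrataDoorOneSliceAxiSeq.hasTypeIDecay_mono hWd (le_max_right _ _))

end EffectiveKeyhole

end Summit.NavierStokesRegularity.NavierStokesRegularity.Cruxes.ScarEnvelopeTypeI.ZoomDictionary
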